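import Summits.NavierStokesRegularity.FluidComputer.PalasekTowerChildCoreLedgerDisc
import Literature.Analysis.FluidPDE.LundgrenStrainedPlanarFlows
import Summits.NavierStokesRegularity.NavierStokesRegularity.Theorems.TautLoopKelvinCirculationFloorBallFlux

/-!
# REGISTER v2.3″ (continued): THE CORE CLAUSE IN STOKES FORM — the rim circle of the ledger disc carries the
# WHOLE disc flux; for the Burgers child `Γ(1 − e^{−x_k/4})`, at every level

Cell `ns-blowup`, seat `ns-blowup-ecbridge-8` (g9); evidence toward crux 19250 `HeredityFromTwo`, floor
`stub_core_floors` / `CoreFloorAt k` (the `CoreLedger` clause: a `C¹` closed loop of speed `≤ 8π/N_{k+1}` in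
a ball of radius `1/N_{k+1}` carrying circulation `≥ c₁N_{k+1}^{β−2}`), MODEL lane «child core = Burgers
vortex in the host strain `c = λA_k` at `ν = 1`» (companion `PalasekTowerLundgrenChildCoreClock`: any
positive log-tame Lundgren cross-section, after the entropy clock).

`PalasekTowerRegisterGlobalCoreFlux` (19249-p2) reads the clause through a FLUX FORM — normal vorticity
`≥ c₁A_{k+1}/(4π)` at EVERY point of the ledger disc of radius `1/N_{k+1}` — and `PalasekTowerChildCoreLedgerDisc`
(g8) showed that for the Burgers child this pointwise form needs `c₁ ≤ C·x_k·e^{−x_k/4}`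
(`x_k = λA_k/N_{k+1}²`) and therefore FAILS up the tower (`x_k → ∞`: the Burgers core becomes much smaller
than the ledger disc and its rim vorticity is tiny). But the clause only asks for the CIRCULATION of a loop,
and by Stokes the rim circle of the ledger disc carries the whole flux through the disc — all of the core's
circulation once the core sits inside the disc. This file types the STOKES FORM:

* §1 `coreClause_of_rimCirculation` (any rates, schedule, level `j`, `C¹` field): if the circle of radius
  `1/N_j` about a point of the tower's ball (orthonormal frame) has circulation `≥ c₁N_j^{β−2}/4`, the field
  meets the level-`j` core clause (the circle wound four times: speed exactly `8π/N_j`; K57-W's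
  `coreLoop_of_winding`);
* §2 `rimCirculation_eq_setIntegral_curl` — Stokes in set-integral form for horizontal circles:
  `∮_{circle(z₀e_z, r)} U·dℓ = ∫_{q₁²+q₂² < r²} (curl U)₂(q₁, q₂, z₀) dq` (`ballFlux_disc` of the
  `CirculationFloor` birth line + `circulation_circleLoop`);
* §3 THE BURGERS CHILD, exactly: `burgersVortex_rimCirculation` — `∮_{circle(z₀e_z, r)} u_B·dℓ = Γ(1 − e^{−cr²/4})`
  (the strain is normal to the circle; the swirl contributes `Γ(1 − e^{−cr²/4})/(2π)` per radian), hence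
  **`palasekTowerBreakdown_burgersChild_coreClause_stokes`**: `c₁ ≤ 4C(1 − e^{−x_k/4})` ⇒ the Burgers child
  `burgersVortex (λA_k) 1 (C·N_{k+1}^{β−2})` meets the level-`(k+1)` clause — a condition that gets EASIER up
  the tower (`x_k ↑`, `_coreRatio_mono`), so **one inequality `c₁ ≤ 4C(1 − e^{−x_2/4})` serves every `k ≥ 2`**
  (`_burgersChild_coreClause_stokes_of_two`); wide rates, `λ = 1`: `x_2 > 1.95`, `4(1 − e^{−x_2/4}) > 1.31`, so
  **`C ≥ 0.77·c₁` suffices at all levels** (`_burgersChild_coreClause_stokes_wide`) — against the flux form's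
  `C ≥ 1.01·c₁` at `k = 2` and NO admissible `C` at large `k`.

WHAT THIS IS NOT: not NS about registered flows; nothing here produces a registered Stage or touches
`NoPrematureBreakdownAt`; the loop is the ledger circle in a plane `{x₂ = z₀}` centred on the vortex axis.

## References
* [cite: MajdaBertozziCUP2002, §1.6 (1.60)–(1.61) (Kelvin/Stokes: circulation = vorticity flux)]
* [cite: Frisch1995, §8.9.1 eq. (8.140) (the Burgers vortex)] · [cite: Palasek2026ElementaryModel, §3.1]
-/

noncomputable section

namespace Summit.NavierStokesRegularity.FluidComputer.PalasekTowerClayBridge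

open Real Set MeasureTheory Function
open scoped RealInnerProductSpace ContDiff
open Literature.Analysis.FluidPDE Literature.Analysis.FluidPDE.Lundgren Literature.Analysis.Calculus
open Summit.NavierStokesRegularity.CoreLedgerWinding
open Summit.NavierStokesRegularity.NavierStokesRegularity.Theorems.CirculationFloor.Birth

namespace CoreLedgerStokes

/-! ### §0 The horizontal frame `(e_x, e_y)`, `e_x × e_y = e_z`, and the coordinate disc -/

/-- `‖e_x‖ = 1`. [folklore] -/
theorem norm_eX : ‖(EuclideanSpace.single 0 (1 : ℝ) : EuclideanSpace ℝ (Fin 3))‖ = 1 := by simp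

/-- `‖e_y‖ = 1`. [folklore] -/
theorem norm_eY : ‖(EuclideanSpace.single 1 (1 : ℝ) : EuclideanSpace ℝ (Fin 3))‖ = 1 := by simp

/-- `⟪e_x, e_y⟫ = 0`. [folklore] -/
theorem inner_eX_eY :
    ⟪(EuclideanSpace.single 0 (1 : ℝ) : EuclideanSpace ℝ (Fin 3)), EuclideanSpace.single 1 (1 : ℝ)⟫ = 0 := by
  simp [EuclideanSpace.inner_single_left]

/-- `e_x × e_y = e_z`. [folklore] -/
theorem cross_eX_eY :
    cross (EuclideanSpace.single 0 (1 : ℝ) : EuclideanSpace ℝ (Fin 3)) (EuclideanSpace.single 1 (1 : ℝ)) = eZ := by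
  ext i
  fin_cases i <;>
    simp [eZ, cross, cross_apply, Matrix.cons_val_zero, Matrix.cons_val_one, Matrix.cons_val_two]

/-- The point `z₀e_z + a e_x + b e_y` is `ι(a, b) + z₀ e_z`. [folklore] -/
theorem frame_point_eq (z₀ a b : ℝ) :
    (z₀ • eZ + a • (EuclideanSpace.single 0 (1 : ℝ) : EuclideanSpace ℝ (Fin 3)) +
        b • (EuclideanSpace.single 1 (1 : ℝ) : EuclideanSpace ℝ (Fin 3))) =
      embedXY (WithLp.toLp 2 ![a, b]) + z₀ • eZ := by
  ext i
  fin_cases i <;> simp [eZ]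

/-- `⟪x, e_z⟫ = x₂`. [folklore] -/
theorem inner_eZ (x : EuclideanSpace ℝ (Fin 3)) : ⟪x, eZ⟫ = x 2 := by
  simp [eZ, EuclideanSpace.inner_single_right]

/-- The coordinate disc is measurable. [folklore] -/
theorem measurableSet_disc (r : ℝ) : MeasurableSet {p : ℝ × ℝ | p.1 ^ 2 + p.2 ^ 2 < r ^ 2} :=
  (isOpen_lt (by fun_prop) continuous_const).measurableSet

/-- The coordinate disc lies in the square `[-r, r]²`. [folklore] -/
theorem disc_subset_square {r : ℝ} (hr : 0 < r) :
    {p : ℝ × ℝ | p.1 ^ 2 + p.2 ^ 2 < r ^ 2} ⊆ Icc (-r) r ×ˢ Icc (-r) r := by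
  intro p hp
  simp only [mem_setOf_eq] at hp
  have h1 : p.1 ^ 2 ≤ r ^ 2 := by nlinarith [sq_nonneg p.2]
  have h2 : p.2 ^ 2 ≤ r ^ 2 := by nlinarith [sq_nonneg p.1]
  exact ⟨abs_le.1 (abs_le_of_sq_le_sq' h1 hr.le |>.elim (fun h h' => abs_le.2 ⟨h, h'⟩)),
    abs_le.1 (abs_le_of_sq_le_sq' h2 hr.le |>.elim (fun h h' => abs_le.2 ⟨h, h'⟩))⟩

/-- A continuous function is integrable on the coordinate disc. [folklore] -/
theorem integrableOn_disc {G : ℝ × ℝ → ℝ} (hG : Continuous G) {r : ℝ} (hr : 0 < r) :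
    IntegrableOn G {p : ℝ × ℝ | p.1 ^ 2 + p.2 ^ 2 < r ^ 2} :=
  (hG.continuousOn.integrableOn_compact (isCompact_Icc.prod isCompact_Icc)).mono_set (disc_subset_square hr)

end CoreLedgerStokes

open CoreLedgerStokes

/-! ### §1 The core clause from the circulation of the rim circle -/

/-- **Rim circulation ⇒ the core clause.** For rates `R`, a schedule `S`, a level `j`, a `C¹` field `w` on `ℝ³`,
a point `x` of the tower's ball and an orthonormal frame `(e₁, e₂)`: if the circle of radius `1/N_j` about `x`
in the plane of the frame has circulation `≥ c₁N_j^{β−2}/4`, then `w` meets the level-`j` CORE CLAUSE — that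
circle wound four times is a `C¹` closed loop in `closedBall x (1/N_j)` of speed exactly `8π/N_j` and
circulation `≥ c₁N_j^{β−2}` (`coreLoop_of_winding`). [cite: Palasek2026ElementaryModel, §3.1] -/
theorem coreClause_of_rimCirculation {R : TowerRates} (S : Schedule R) (j : ℕ)
    {w : EuclideanSpace ℝ (Fin 3) → EuclideanSpace ℝ (Fin 3)} (hw : ContDiff ℝ 1 w)
    {x e₁ e₂ : EuclideanSpace ℝ (Fin 3)} (hx : ‖x‖ ≤ S.radius) (he₁ : ‖e₁‖ = 1) (he₂ : ‖e₂‖ = 1)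
    (h12 : ⟪e₁, e₂⟫ = 0)
    (hcirc : S.c₁ * R.N j ^ (R.β - 2) / 4 ≤ circulation w (circleLoop x (1 / R.N j) e₁ e₂)) :
    ∃ (x' : EuclideanSpace ℝ (Fin 3)) (γ : ℝ → EuclideanSpace ℝ (Fin 3)),
      ‖x'‖ ≤ S.radius ∧ ContDiff ℝ 1 γ ∧ γ 0 = γ 1 ∧
      (∀ σ ∈ Icc (0 : ℝ) 1, γ σ ∈ Metric.closedBall x' (1 / R.N j)) ∧
      (∀ σ ∈ Icc (0 : ℝ) 1, ‖deriv γ σ‖ ≤ 8 * π / R.N j) ∧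
      S.c₁ * R.N j ^ (R.β - 2) ≤ circulation w γ := by
  have hN := R.N_pos j
  have hr : 0 ≤ 1 / R.N j := by positivity
  obtain ⟨γ, hγ, hloop, hball, hspeed, hΓ⟩ := coreLoop_of_winding (S := S) (j := j) hw.continuous
    (m := 4) (by norm_num) (contDiff_circleLoop x (1 / R.N j) e₁ e₂) (periodic_circleLoop x (1 / R.N j) e₁ e₂)
    (fun σ => by
      rw [Metric.mem_closedBall, dist_eq_norm, norm_circleLoop_sub_centre_frame he₁ he₂ h12 x hr])
    (fun σ => by
      rw [norm_deriv_circleLoop_frame he₁ he₂ h12 x hr]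
      apply le_of_eq; push_cast; field_simp; ring)
    (by push_cast; linarith)
  exact ⟨x, γ, hx, hγ, hloop, hball, hspeed, hΓ⟩

/-! ### §2 Stokes in set-integral form for horizontal circles -/

/-- **`∮_{circle(z₀e_z, r)} U·dℓ = ∫_{q₁² + q₂² < r²} (curl U)₂(q₁, q₂, z₀) dq`** for a `C¹` field `U` on `ℝ³`
and `r > 0` (the disc flux of the `CirculationFloor` birth line, `ballFlux_disc`, with the horizontal frame
`e_x × e_y = e_z`). [cite: MajdaBertozziCUP2002, §1.6 (1.60)–(1.61)] -/
theorem rimCirculation_eq_setIntegral_curl {U : EuclideanSpace ℝ (Fin 3) → EuclideanSpace ℝ (Fin 3)}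
    (hU : ContDiff ℝ 1 U) (z₀ : ℝ) {r : ℝ} (hr : 0 < r) :
    circulation U (circleLoop (z₀ • eZ) r (EuclideanSpace.single 0 1) (EuclideanSpace.single 1 1)) =
      ∫ p in {p : ℝ × ℝ | p.1 ^ 2 + p.2 ^ 2 < r ^ 2},
        curl U (embedXY (WithLp.toLp 2 ![p.1, p.2]) + z₀ • eZ) 2 := by
  rw [circulation_circleLoop, ← ballFlux_disc hU (z₀ • eZ) _ _ hr]
  refine setIntegral_congr_fun (measurableSet_disc r) fun p _ => ?_
  rw [cross_eX_eY, inner_eZ, frame_point_eq]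

/-! ### §3 The Burgers child: the rim circle of radius `r` carries `Γ(1 − e^{−cr²/4})` -/

/-- **`∮_{circle(z₀e_z, r)} u_B·dℓ = Γ(1 − e^{−cr²/4})`** for the Burgers vortex `burgersVortex c 1 Γ`
(strain `c(−½x₀, −½x₁, x₂)` + swirl `Γ(2πρ²)⁻¹(1 − e^{−cρ²/4})(−x₁, x₀, 0)`): the strain is normal to the
circle and the swirl contributes `Γ(1 − e^{−cr²/4})/(2π)` per radian. (All real `c, Γ, z₀, r`.)
[cite: Frisch1995, §8.9.1 eq. (8.140); MajdaBertozziCUP2002, §1.6] -/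
theorem burgersVortex_rimCirculation (c Γ z₀ r : ℝ) :
    circulation (burgersVortex c 1 Γ)
        (circleLoop (z₀ • eZ) r (EuclideanSpace.single 0 1) (EuclideanSpace.single 1 1)) =
      Γ * (1 - exp (-(c * r ^ 2 / 4))) := by
  rw [circulation_circleLoop]
  have hpt : ∀ θ : ℝ,
      ⟪burgersVortex c 1 Γ (z₀ • eZ + (r * cos θ) • (EuclideanSpace.single 0 (1 : ℝ)) +
          (r * sin θ) • (EuclideanSpace.single 1 (1 : ℝ))),
        (-(r * sin θ)) • (EuclideanSpace.single 0 (1 : ℝ) : EuclideanSpace ℝ (Fin 3)) +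
          (r * cos θ) • (EuclideanSpace.single 1 (1 : ℝ))⟫ =
      Γ * (1 - exp (-(c * r ^ 2 / 4))) / (2 * π) := by
    intro θ
    set p : EuclideanSpace ℝ (Fin 3) := z₀ • eZ + (r * cos θ) • (EuclideanSpace.single 0 (1 : ℝ)) +
      (r * sin θ) • (EuclideanSpace.single 1 (1 : ℝ)) with hp
    have hp0 : p 0 = r * cos θ := by simp [hp, eZ]
    have hp1 : p 1 = r * sin θ := by simp [hp, eZ]
    have hsum : p 0 ^ 2 + p 1 ^ 2 = r ^ 2 := by
      rw [hp0, hp1]; nlinarith [sin_sq_add_cos_sq θ]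
    have hv0 : burgersVortex c 1 Γ p 0 =
        -c / 2 * p 0 + c * Γ / (8 * π * 1) * burgersPhi (c * (p 0 ^ 2 + p 1 ^ 2) / (4 * 1)) * (-p 1) := by
      simp [burgersVortex, axisymmetricStrain, burgersVortexSwirl]
    have hv1 : burgersVortex c 1 Γ p 1 =
        -c / 2 * p 1 + c * Γ / (8 * π * 1) * burgersPhi (c * (p 0 ^ 2 + p 1 ^ 2) / (4 * 1)) * p 0 := by
      simp [burgersVortex, axisymmetricStrain, burgersVortexSwirl]
    rw [hsum] at hv0 hv1
    have hinner : ⟪burgersVortex c 1 Γ p,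
        (-(r * sin θ)) • (EuclideanSpace.single 0 (1 : ℝ) : EuclideanSpace ℝ (Fin 3)) +
          (r * cos θ) • (EuclideanSpace.single 1 (1 : ℝ))⟫ =
        (-(r * sin θ)) * burgersVortex c 1 Γ p 0 + (r * cos θ) * burgersVortex c 1 Γ p 1 := by
      rw [inner_add_right, inner_smul_right, inner_smul_right, EuclideanSpace.inner_single_right,
        EuclideanSpace.inner_single_right]
      simp
    rw [hinner, hv0, hv1, hp0, hp1]
    have key : c * Γ / (8 * π * 1) * burgersPhi (c * r ^ 2 / (4 * 1)) * r ^ 2 =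
        Γ * (1 - exp (-(c * r ^ 2 / 4))) / (2 * π) := by
      rw [show c * r ^ 2 / (4 * 1) = c * r ^ 2 / 4 by ring, ← mul_burgersPhi (c * r ^ 2 / 4)]
      field_simp
      ring
    have hsc : sin θ ^ 2 + cos θ ^ 2 = 1 := sin_sq_add_cos_sq θ
    calc -(r * sin θ) * (-c / 2 * (r * cos θ) +
            c * Γ / (8 * π * 1) * burgersPhi (c * r ^ 2 / (4 * 1)) * -(r * sin θ)) +
          r * cos θ * (-c / 2 * (r * sin θ) + c * Γ / (8 * π * 1) * burgersPhi (c * r ^ 2 / (4 * 1)) * (r * cos θ))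
        = c * Γ / (8 * π * 1) * burgersPhi (c * r ^ 2 / (4 * 1)) * r ^ 2 * (sin θ ^ 2 + cos θ ^ 2) := by ring
      _ = Γ * (1 - exp (-(c * r ^ 2 / 4))) / (2 * π) := by rw [hsc, mul_one, key]
  simp_rw [hpt]
  rw [intervalIntegral.integral_const, smul_eq_mul]
  field_simp
  ring

/-- `x_k` is non-decreasing up the tower: `x_2 ≤ x_k` for `k ≥ 2` (`x_k = λN_k^{β−2b}`, `β − 2b > 0`,
`N_k = N₀^{b^k}` increasing; `λ ≥ 0`). [folklore] -/
theorem palasekTowerBreakdown_coreRatio_mono (R : TowerRates) {k : ℕ} (hk : 2 ≤ k) {l : ℝ} (hl : 0 ≤ l) :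
    l * R.N 2 ^ (R.β - 2 * R.b) ≤ l * R.N k ^ (R.β - 2 * R.b) := by
  have hexp : 0 ≤ R.β - 2 * R.b := by linarith [R.two_b_lt_β]
  have hN : R.N 2 ≤ R.N k := by
    unfold TowerRates.N
    exact Real.rpow_le_rpow_of_exponent_le R.one_lt_N₀.le (pow_le_pow_right₀ R.one_lt_b.le hk)
  exact mul_le_mul_of_nonneg_left (Real.rpow_le_rpow (R.N_pos 2).le hN hexp) hl

/-- **THE BURGERS CHILD MEETS THE CORE CLAUSE IN STOKES FORM IFF `c₁ ≤ 4C(1 − e^{−x_k/4})`** (the «if»; any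
rates, any schedule with `radius ≥ 0`, level `k`, strain `λA_k`, `ν = 1`, circulation `C·N_{k+1}^{β−2}`): the
ledger circle of radius `1/N_{k+1}` about the axis carries circulation `C·N_{k+1}^{β−2}(1 − e^{−x_k/4})`
(`burgersVortex_rimCirculation`, `x_k/4 = λA_k/(4N_{k+1}²)`), so under the displayed inequality the circle wound
four times is a `CoreLedger`-admissible loop (`coreClause_of_rimCirculation`). Contrast the flux form
`c₁ ≤ C·x_k·e^{−x_k/4}` of `_burgersChild_coreClause` (`x e^{−x/4} ≤ 4(1 − e^{−x/4})`, and `→ 0`).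
[cite: Frisch1995, §8.9.1 eq. (8.140); Palasek2026ElementaryModel, §3.1] -/
theorem palasekTowerBreakdown_burgersChild_coreClause_stokes (R : TowerRates) (Sch : Schedule R)
    (hrad : 0 ≤ Sch.radius) (k : ℕ) (l C : ℝ)
    (hP : Sch.c₁ ≤ 4 * C * (1 - exp (-(l * R.N k ^ (R.β - 2 * R.b)) / 4))) :
    ∃ (x' : EuclideanSpace ℝ (Fin 3)) (γ : ℝ → EuclideanSpace ℝ (Fin 3)),
      ‖x'‖ ≤ Sch.radius ∧ ContDiff ℝ 1 γ ∧ γ 0 = γ 1 ∧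
      (∀ σ ∈ Icc (0 : ℝ) 1, γ σ ∈ Metric.closedBall x' (1 / R.N (k + 1))) ∧
      (∀ σ ∈ Icc (0 : ℝ) 1, ‖deriv γ σ‖ ≤ 8 * π / R.N (k + 1)) ∧
      Sch.c₁ * R.N (k + 1) ^ (R.β - 2) ≤
        circulation (burgersVortex (l * R.A k) 1 (C * R.N (k + 1) ^ (R.β - 2))) γ := by
  have hN1 := R.N_pos (k + 1)
  have hNβ : 0 < R.N (k + 1) ^ (R.β - 2) := Real.rpow_pos_of_pos hN1 _
  refine coreClause_of_rimCirculation Sch (k + 1) (contDiff_burgersVortex _ _ _) (x := (0 : ℝ) • eZ)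
    (by simpa using hrad) norm_eX norm_eY inner_eX_eY ?_
  rw [burgersVortex_rimCirculation]
  have hx : l * R.A k * (1 / R.N (k + 1)) ^ 2 / 4 = l * R.N k ^ (R.β - 2 * R.b) / 4 := by
    rw [← palasekTowerBreakdown_coreRatio_eq]; field_simp
  rw [hx, show -(l * R.N k ^ (R.β - 2 * R.b) / 4) = -(l * R.N k ^ (R.β - 2 * R.b)) / 4 by ring]
  have h := mul_le_mul_of_nonneg_right hP hNβ.le
  nlinarith [h]

/-- **ONE INEQUALITY FOR EVERY LEVEL**: if `c₁ ≤ 4C(1 − e^{−x_2/4})` (`C ≥ 0`, `λ ≥ 0`) then at EVERY `k ≥ 2` the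
Burgers child `burgersVortex (λA_k) 1 (C·N_{k+1}^{β−2})` meets the level-`(k+1)` core clause — `x_k ≥ x_2`
(`_coreRatio_mono`): the Stokes form gets easier up the tower, where the flux form failed.
[cite: Palasek2026ElementaryModel, §3.1] -/
theorem palasekTowerBreakdown_burgersChild_coreClause_stokes_of_two (R : TowerRates) (Sch : Schedule R)
    (hrad : 0 ≤ Sch.radius) {k : ℕ} (hk : 2 ≤ k) {l C : ℝ} (hl : 0 ≤ l) (hC : 0 ≤ C)
    (hP : Sch.c₁ ≤ 4 * C * (1 - exp (-(l * R.N 2 ^ (R.β - 2 * R.b)) / 4))) :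
    ∃ (x' : EuclideanSpace ℝ (Fin 3)) (γ : ℝ → EuclideanSpace ℝ (Fin 3)),
      ‖x'‖ ≤ Sch.radius ∧ ContDiff ℝ 1 γ ∧ γ 0 = γ 1 ∧
      (∀ σ ∈ Icc (0 : ℝ) 1, γ σ ∈ Metric.closedBall x' (1 / R.N (k + 1))) ∧
      (∀ σ ∈ Icc (0 : ℝ) 1, ‖deriv γ σ‖ ≤ 8 * π / R.N (k + 1)) ∧
      Sch.c₁ * R.N (k + 1) ^ (R.β - 2) ≤
        circulation (burgersVortex (l * R.A k) 1 (C * R.N (k + 1) ^ (R.β - 2))) γ := by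
  refine palasekTowerBreakdown_burgersChild_coreClause_stokes R Sch hrad k l C (hP.trans ?_)
  have hmono := palasekTowerBreakdown_coreRatio_mono R hk hl
  have hexp : exp (-(l * R.N k ^ (R.β - 2 * R.b)) / 4) ≤ exp (-(l * R.N 2 ^ (R.β - 2 * R.b)) / 4) :=
    exp_le_exp.2 (by linarith)
  nlinarith [hexp]

/-- **WIDE RATES, `λ = 1`: `C ≥ 0.77·c₁` SUFFICES AT EVERY LEVEL `k ≥ 2`** (`x_2 > 1.95`,
`e^{−x_2/4} ≤ 1/(1 + x_2/4) < 0.6723`, `4·0.77·(1 − 0.6723) > 1`) — against the flux form's `C ≥ 1.01·c₁` at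
`k = 2` only (`_burgersChild_coreClause_wide_two`). MODEL statement; not about any registered flow.
[cite: Palasek2026ElementaryModel, §3.1] -/
theorem palasekTowerBreakdown_burgersChild_coreClause_stokes_wide (Sch : Schedule TowerRates.wide)
    (hrad : 0 ≤ Sch.radius) {k : ℕ} (hk : 2 ≤ k) {C : ℝ} (hC : 0.77 * Sch.c₁ ≤ C) :
    ∃ (x' : EuclideanSpace ℝ (Fin 3)) (γ : ℝ → EuclideanSpace ℝ (Fin 3)),
      ‖x'‖ ≤ Sch.radius ∧ ContDiff ℝ 1 γ ∧ γ 0 = γ 1 ∧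
      (∀ σ ∈ Icc (0 : ℝ) 1, γ σ ∈ Metric.closedBall x' (1 / TowerRates.wide.N (k + 1))) ∧
      (∀ σ ∈ Icc (0 : ℝ) 1, ‖deriv γ σ‖ ≤ 8 * π / TowerRates.wide.N (k + 1)) ∧
      Sch.c₁ * TowerRates.wide.N (k + 1) ^ (TowerRates.wide.β - 2) ≤
        circulation (burgersVortex (1 * TowerRates.wide.A k) 1
          (C * TowerRates.wide.N (k + 1) ^ (TowerRates.wide.β - 2))) γ := by
  have hc₁ := Sch.c₁_pos
  have hC0 : 0 ≤ C := by nlinarith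
  refine palasekTowerBreakdown_burgersChild_coreClause_stokes_of_two TowerRates.wide Sch hrad hk zero_le_one
    hC0 ?_
  obtain ⟨hlo, -⟩ := wide_coreRatio_two_bounds
  set x : ℝ := TowerRates.wide.N 2 ^ (TowerRates.wide.β - 2 * TowerRates.wide.b) with hx
  rw [one_mul]
  -- `e^{-x/4} ≤ 1/(1 + x/4) ≤ 1/1.4875`
  have hx0 : 0 < 1 + x / 4 := by linarith
  have he : exp (-x / 4) ≤ (1 + x / 4)⁻¹ := by
    rw [show -x / 4 = -(x / 4) by ring, Real.exp_neg, inv_le_inv₀ (exp_pos _) hx0]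
    linarith [add_one_le_exp (x / 4)]
  have hinv : (1 + x / 4)⁻¹ ≤ 0.6723 := by
    rw [inv_le_comm₀ hx0 (by norm_num)]
    norm_num; linarith
  nlinarith [he, hinv]

end Summit.NavierStokesRegularity.FluidComputer.PalasekTowerClayBridge
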